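import Summits.HodgeConjecture.HodgeConjecture.Theorems.F0LD1ArchTypeAwayCoreOfInvariant
import Summits.HodgeConjecture.HodgeConjecture.Theorems.F0LD2ArchTypeAway
import HarnessLib

-- As in the lineage (★ `F0LD2ArchTypeAway`): the binder list and the theta telescope are large; elaborate sequentially.
set_option Elab.async false

/-!
# Crux `HLiu418`, ROAD O brick (β-away): [Liu2021, App. D Lem. D.2 (1)] AWAY FROM `ι` for a discrete `P` of `U(H)` that MEETS a theta lift from a line and
# carries ONE non-zero vector fixed by the compact archimedean factor `K_c(w(ι))` — the raw table `(m, sign) ∈ {(−1, −), (1, +)}` at every `τ′` off the place of `ι`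
# (★ `F0LD2ArchTypeAway.archTypeAway₂_holds` with the cone frame `𝔣` dropped and `IsHolCotangentAt₂` replaced by the invariant-vector hypothesis)

Cell hodgecm-mathlib (D-0151), FLOOR 0; crux item `HLiu418` = stmt-HodgeConjecture-24832 (route `HCCMUnconditional`); ROAD O («orthogonal copy», memo
`F0/P6/LD/LD1-p01/g5/ROAD-O-orthogonal-copy.v1.LD1-p01g5.md` §2 (ii); chair LD1-plan (g3) HANDS v4 2026-09-02T13:06:19Z; critic LD-ref1 (g3) BOX ROAD-O #5
13:06:32Z): brick **(β-away)**, seat LD1-p02 (g6).  THEOREMS ONLY (no `def`, no instance, no notation, no named fact, no `sorry`); `--supports stmt-HodgeConjecture-24832`.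
HC_CM is proved only modulo the 7 printed citations (2 remaining: hLiu418 = stmt-HodgeConjecture-24832, h413 = stmt-HodgeConjecture-24833) until rung 0 closes; ROAD O
bypasses the printed letter (B6) for hol `P` only and moves no digit until the LD leaves' ED. 11 is BUILT; this file asserts one archimedean table and nothing else.

THE STATEMENT = ★ `F0LD2ArchTypeAway.archTypeAway₂_holds` TOKEN FOR TOKEN except: the cone-frame binder `∀ (𝔣 : ConeFrame L H (cmPlace L ι))` is DROPPED and the
Hodge-type hypothesis `P.IsHolCotangentAt₂ … (cmPlace L ι) 𝔣 →` is REPLACED, at the same position, by the INVARIANT-VECTOR hypothesis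
  `(∃ w ∈ P.space.toSubmodule, w ≠ 0 ∧ ∀ k ∈ K_c(w(ι)), R(k) w = w) →`,   `K_c(w(ι)) = (ker archAt (cmPlace L ι)).map archToAdelic`
(LD-ref1 BOX #5's `hinv`).  WHY THIS IS THE RIGHT CUT (tree-read): in the ★ proof the Hodge type is consumed at ONE line (★ :166, the hol test vector
`exists_toLp_ne_zero_of_isHolCotangentAt₂`), whose data feed the ★ cores only through «`P` is fixed by `K_c(w(ι))` vector by vector» (★
`F0LD2CurveHolTestVector.rightRegular_starProjection_of_mem_kerArchAt₂`); ONE non-zero `K_c`-fixed vector gives the same fact (★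
`DiscreteAutomorphicRep.rightRegular_eq_self_of_normal`, packaged as ★ `F0LD1ArchTypeAwayKcOfInvariant.rightRegular_eq_self_of_exists_fixed`), and the cores are
re-threaded over it in ★ `F0LD1ArchTypeAwayKcOfInvariant` ∕ ★ `F0LD1ArchTypeAwayCoreOfInvariant` (`…_of_fixed`).  The proof below is the ★ proof verbatim with ★ :166 replaced by that door and the two
core calls re-pointed.  ROLE ON ROAD O: the pin assembly `F0LD1ThetaSpanPinOfBricks` (LD1-p01) applies this head to the closed theta spans `Q := Q̄(a′,ξ)` and
`Q″ := Q̄(a″,ξ″)` (each MEETS its own line by its own generator), with the invariant vector TRANSPORTED from one hol test vector of the hol₂ `P₀` along the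
unitary equivalences `P₀ ≃ᵤ Q`, `P₀ ≃ᵤ Q″` (★ `F0LD1UnitaryEquivTransport.exists_mem_ne_zero_laws_of_areUnitarilyEquivalent`: the (Kc) clause of ★ `holCotForms₂`
is a law «`R(k) w = w`»), supplying the total positivity of `a″/a′` at the places `τ′ ≠ ι` for the Hasse step.

HONEST SCOPE.  Junk check (LD-ref1 criteria): `hmeet` (the witness), the invariant vector (door ⇒ `hKc` ⇒ the cores' `U(V_{w₀})`-invariance), `hdef` (compactness + sign
split + `σ_{v₀}(dV) > 0`), `h4`, the pin, `ht`∕`hg` are all consumed; `hsig` is idle exactly as in ★ (the away-from-`ι` computation never reads the signature at `ι`).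
Without the invariant vector a `P` non-trivial at some definite `w₀` breaks the table; without `MeetsThetaLiftFromLine` at THIS `(μ′, a′)` the table is about an
unrelated pair.  (β-away) ⇒ ★ `archTypeAway₂_holds` (a hol₂ `P` has such a vector: ★ `exists_toLp_ne_zero_of_isHolCotangentAt₂` + clause (Kc)), not conversely.

References: [Liu2021] Y. Liu, Camb. J. Math. 9 (2021) = arXiv:2102.11518, App. D Lem. D.2 (1) (p. 127, l. 5283), proof of Prop. 4.13 Case 1 (l. 2137–2141,
p. 48), proof of Prop. D.4 (1) (p. 130–131); [KonnoKonno2007] Kyushu J. Math. 61 (2007), Thm. 5.4; [KashiwaraVergne1978] Invent. Math. 44 (1978), (5.1)–(5.5);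
[Folland1989] Prop. (4.39), (4.76); [GelbartRogawski1991] Invent. Math. 105 (1991), §3.1 Prop. 3.1.1; [BorelJacquet1979] PSPM 33.1 (1979), §4.1, §4.6;
[PlatonovRapinchuk1994] §2.3, §5.3 Thm. 5.5; [DeitmarEchterhoff2014] Thm. 7.3.2.
-/

set_option autoImplicit false
-- the mandated namespace has the single-problem summit's repeated segment (`HodgeConjecture.HodgeConjecture`)
set_option linter.dupNamespace false

noncomputable section

open NumberField NumberField.InfinitePlace MeasureTheory IsDedekindDomain
open scoped Matrix ComplexOrder ENNReal TensorProduct SchwartzMap Kronecker Classical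

namespace Summit.HodgeConjecture.HodgeConjecture.Cruxes.HLiu418.F0LD1ArchTypeAwayOfInvariant

open _root_.MeasureTheory
open Literature.NumberTheory.Automorphic Literature.NumberTheory.Automorphic.UnitaryGroup
open Literature.NumberTheory.Automorphic.UnitaryGroup.CotangentForms
open Literature.NumberTheory.Automorphic.UnitaryCurveForms
open Literature.NumberTheory.Automorphic.IdeleClassGroup
open Literature.NumberTheory.Automorphic.Liu2021
open Literature.NumberTheory.Automorphic.Liu2021.Def411WeilCarriers
open Literature.NumberTheory.Automorphic.Liu2021.Def411WeilCarriersDoubling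
open Literature.NumberTheory.GelbartRogawski1991 Literature.NumberTheory.GelbartRogawski1991.UnitaryDualPair
open Literature.NumberTheory.GelbartRogawski1991.GRConstruction
open Literature.NumberTheory.Weil1964
open Literature.RepresentationTheory.Liu2021
open Literature.RepresentationTheory.HeisenbergGroup Literature.Analysis.SegalBargmann
open Literature.RepresentationTheory.KonnoKonno2007 Literature.RepresentationTheory.CompactGroups
open F0LD2ArchTypeAwayCore
open F0LD2ArchTypeAway F0LD1ArchTypeAwayKcOfInvariant F0LD1ArchTypeAwayCoreOfInvariant

/-! ## The head: (β-away) -/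

set_option maxHeartbeats 4000000 in
-- (the binder list and the theta telescope are large; every step is a named ★ lemma — as ★ `archTypeAway₂_holds`)
/-- **(β-away) — [Liu2021, App. D Lem. D.2 (1)] at `n = 2` off the place of `ι`, for a `P` MEETING a theta lift from a line and carrying ONE non-zero
`K_c(w(ι))`-fixed vector**: in the frame of letter #74 (CM field `L` with `[L:ℚ] ≥ 4`, scaled rational frame `ᵗ(c̄ g)·(t • H)·g = diag dV`, `diag dV` of
signature `(1,1)` at `ι` and definite elsewhere, pinned adelic transport `ιA`, `[U(diag dV)]` compact), a discrete `P` of `U(H)` MEETING the global theta lift from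
the hermitian line `⟨a′⟩` at the conjugate-symplectic `μ′` along `ιA` and containing a non-zero vector fixed by `K_c(w(ι)) = (ker archAt (cmPlace L ι)).map archToAdelic`
has, at every embedding `τ′` off the place of `ι`, raw archimedean parameters `(m, sign) ∈ {(−1, −), (1, +)}` — «among the representations `ω_{n,0}^{m,±,l}`, only
`ω_{n,0}^{1,+,0}` and `ω_{n,0}^{−1,−,0}` are the trivial character» (`P_{w₀}` is trivial at the definite place `w₀ = w(τ′)`).  The type is ★ `archTypeAway₂_holds`'s with
`𝔣` dropped and `IsHolCotangentAt₂` ↦ the invariant vector; the proof is ★'s with the door ★ `rightRegular_eq_self_of_exists_fixed` at ★ :166 and the cores ★ `…_of_fixed`.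
[cite: Liu2021, App. D Lem. D.2 (1) (p. 127, l. 5283); Prop. 4.13 proof Case 1 (l. 2137–2141, p. 48); Rem. 4.2 ∕ Def. 4.3]
[cite: KonnoKonno2007, Thm. 5.4] [cite: KashiwaraVergne1978, (5.1)–(5.5)] [cite: Folland1989, Prop. (4.76)] [cite: BorelJacquet1979, §4.6] [cite: DeitmarEchterhoff2014, Thm. 7.3.2] -/
theorem archTypeAway₂_of_invariant :
  ∀ (L : Type) [Field L] [NumberField L] [IsCMField L] (ι : L →+* ℂ) (H : Matrix (Fin 2) (Fin 2) L)
    (dV : Fin 2 → L) (hdV : ∀ i, IsCMField.complexConj L (dV i) = dV i) (hdV0 : ∀ i, dV i ≠ 0)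
    (t : L) (ht : t ≠ 0) (g : GL (Fin 2) L)
    (hg : formCongr ((IsCMField.complexConj L : L ≃ₐ[↥(maximalRealSubfield L)] L) : L →+* L) g (t • H) = Matrix.diagonal dV),
    (∃ T : GL (Fin 2) ℂ, formCongr (starRingEnd ℂ) T ((Matrix.diagonal dV).map ι) = Matrix.diagonal ![(1 : ℂ), -1]) →
    (∀ τ' : L →+* ℂ, InfinitePlace.mk τ' ≠ InfinitePlace.mk ι → ((Matrix.diagonal dV).map τ').PosDef) →
    4 ≤ Module.finrank ℚ L →
    ∀ (μ : Measure (adelicGroupData (↥(maximalRealSubfield L)) L (IsCMField.complexConj L) 2 H).automorphicQuotient)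
      [(adelicGroupData (↥(maximalRealSubfield L)) L (IsCMField.complexConj L) 2 H).IsAutomorphicMeasure μ]
      {n' : ℕ} (e₁ : Fin 2 × Fin 1 ≃ Fin n')
      (ιA : (adelicGroupData (↥(maximalRealSubfield L)) L (IsCMField.complexConj L) 2 H).Adelic →*
        ↥(UnitaryGroup.adelic (↥(maximalRealSubfield L)) L (IsCMField.complexConj L) 2 (Matrix.diagonal dV))),
      (∀ k, ((ιA k : ↥(UnitaryGroup.adelic (↥(maximalRealSubfield L)) L (IsCMField.complexConj L) 2 (Matrix.diagonal dV))) :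
            GL (Fin 2) (AdeleRing (𝓞 L) L)) =
          (toAdeleGL L g)⁻¹ * adelicVal (↥(maximalRealSubfield L)) L (IsCMField.complexConj L) 2 H k * toAdeleGL L g) →
    ∀ [CompactSpace (↥(UnitaryGroup.adelic (↥(maximalRealSubfield L)) L (IsCMField.complexConj L) 2 (Matrix.diagonal dV)) ⧸
        (UnitaryGroup.toAdelic (↥(maximalRealSubfield L)) L (IsCMField.complexConj L) 2 (Matrix.diagonal dV)).range)],
    ∀ (P : DiscreteAutomorphicRep (adelicGroupData (↥(maximalRealSubfield L)) L (IsCMField.complexConj L) 2 H) μ)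
      (μ' : Literature.NumberTheory.Automorphic.IdeleClassGroup L →ₜ* Circle) (hμ' : IsConjugateSymplectic L μ')
      (a' : (↥(maximalRealSubfield L))ˣ),
      MeetsThetaLiftFromLine L 2 H e₁ dV hdV hdV0 P μ' hμ' a' ιA →
      (∃ w ∈ P.space.toSubmodule, w ≠ 0 ∧
        ∀ k ∈ ((archAt (↥(maximalRealSubfield L)) L (IsCMField.complexConj L) 2 H (cmPlace L ι)
            (UnitaryGroup.complexConj_smul_infinitePlace L (cmPlace L ι).1) (IsCMField.complexConj_ne_one L)).ker).map
          (archToAdelic (↥(maximalRealSubfield L)) L (IsCMField.complexConj L) 2 H),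
          (adelicGroupData (↥(maximalRealSubfield L)) L (IsCMField.complexConj L) 2 H).rightRegular μ k w = w) →
      ∀ τ' : L →+* ℂ, InfinitePlace.mk τ' ≠ InfinitePlace.mk ι →
        (exponentAt hμ'.infinityType τ' = -1 ∧ (τ' (algebraMap (↥(maximalRealSubfield L)) L a' * (2 * imagUnit L)⁻¹)).im < 0) ∨
          (exponentAt hμ'.infinityType τ' = 1 ∧ 0 < (τ' (algebraMap (↥(maximalRealSubfield L)) L a' * (2 * imagUnit L)⁻¹)).im) := by
  intro L _ _ _ ι H dV hdV hdV0 t ht g hg _hsig hdef h4 μA _ n' e₁ ιA hpin _ P μ hμ a hmeet hinv τ' hτ'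
  -- `[U(H)]` is compact: `H` is anisotropic, being similar (scaled frame) to `diag dV`, definite at a place off `ι`
  obtain ⟨τc, hτc⟩ := UnitaryGroup.exists_infinitePlace_ne L h4 ι
  haveI : CompactSpace (adelicGroupData (↥(maximalRealSubfield L)) L (IsCMField.complexConj L) 2 H).automorphicQuotient :=
    UnitaryGroup.compactSpace_adelicGroupData_automorphicQuotient L 2 H
      (UnitaryGroup.anisotropic_of_formCongr_smul_eq_of_posDef L 2 H dV t ht g hg τc (hdef τc hτc))
  -- the transport hypotheses of the pinned `ιA`
  have hιA : Continuous ιA ∧ ∀ ⦃γ : (adelicGroupData (↥(maximalRealSubfield L)) L (IsCMField.complexConj L) 2 H).Adelic⦄,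
      γ ∈ (UnitaryGroup.toAdelic (↥(maximalRealSubfield L)) L (IsCMField.complexConj L) 2 H).range →
        ιA γ ∈ (UnitaryGroup.toAdelic (↥(maximalRealSubfield L)) L (IsCMField.complexConj L) 2 (Matrix.diagonal dV)).range :=
    ⟨F0LD2FrameTransportPin.continuous_of_pin L 2 H dV g ιA hpin,
      fun _ hγ => F0LD2FrameTransportPin.mem_range_toAdelic_of_pin L 2 H dV t ht g hg ιA hpin hγ⟩
  -- THE DOOR (replaces ★'s hol test vector): `P` is fixed by `K_c(w(ι))` vector by vector, from the ONE invariant vector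
  have hKc : ∀ k ∈ ((archAt (↥(maximalRealSubfield L)) L (IsCMField.complexConj L) 2 H (cmPlace L ι)
      (UnitaryGroup.complexConj_smul_infinitePlace L (cmPlace L ι).1) (IsCMField.complexConj_ne_one L)).ker).map
      (archToAdelic (↥(maximalRealSubfield L)) L (IsCMField.complexConj L) 2 H),
      ∀ v ∈ P.space, (adelicGroupData (↥(maximalRealSubfield L)) L (IsCMField.complexConj L) 2 H).rightRegular μA k v = v :=
    rightRegular_eq_self_of_exists_fixed P hinv
  -- the seam, unfolded
  letI : MeasurableSpace (↥(UnitaryGroup.adelic (↥(maximalRealSubfield L)) L (IsCMField.complexConj L) 1 (JW (↥(maximalRealSubfield L)) L a)) ⧸ (UnitaryGroup.toAdelic (↥(maximalRealSubfield L)) L (IsCMField.complexConj L) 1 (JW (↥(maximalRealSubfield L)) L a)).range) := borel _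
  haveI : BorelSpace (↥(UnitaryGroup.adelic (↥(maximalRealSubfield L)) L (IsCMField.complexConj L) 1 (JW (↥(maximalRealSubfield L)) L a)) ⧸ (UnitaryGroup.toAdelic (↥(maximalRealSubfield L)) L (IsCMField.complexConj L) 1 (JW (↥(maximalRealSubfield L)) L a)).range) := ⟨rfl⟩
  haveI := normal_range_toAdelic_JW L a
  obtain ⟨hρ, μW, hfinm, hinv, f, Φ, hθ, hθmem, hθne⟩ := hmeet
  haveI : IsFiniteMeasure μW := hfinm
  haveI : SMulInvariantMeasure ↥(UnitaryGroup.adelic (↥(maximalRealSubfield L)) L (IsCMField.complexConj L) 1 (JW (↥(maximalRealSubfield L)) L a)) (↥(UnitaryGroup.adelic (↥(maximalRealSubfield L)) L (IsCMField.complexConj L) 1 (JW (↥(maximalRealSubfield L)) L a)) ⧸ (UnitaryGroup.toAdelic (↥(maximalRealSubfield L)) L (IsCMField.complexConj L) 1 (JW (↥(maximalRealSubfield L)) L a)).range) μW := hinv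
  -- PURE-TENSOR witness with non-zero projection (no `χ`-descent: the core is stated for a general weight `f`)
  have hθ' : (P.space.toSubmodule.starProjection : Lp ℂ 2 μA →ₗ[ℂ] Lp ℂ 2 μA)
      (MemLp.toLp _ (F0LD1ThetaTransportKit.memLp_toQuotFun_lineThetaLift L 2 H e₁ dV hdV hdV0 ιA hιA μ hμ a hρ μW Φ f μA 2)) ≠ 0 := by
    have hrw : MemLp.toLp _ (F0LD1ThetaTransportKit.memLp_toQuotFun_lineThetaLift L 2 H e₁ dV hdV hdV0 ιA hιA μ hμ a hρ μW Φ f μA 2) =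
        MemLp.toLp _ hθ := rfl
    rw [hrw, ContinuousLinearMap.coe_coe, Submodule.starProjection_eq_self_iff.mpr hθmem]
    exact hθne
  obtain ⟨Φinf, Φfin, hfin, hne⟩ := F0LD2ThetaTensorClasses.exists_tensor_of_apply_toLp_lineThetaLift_ne_zero L 2 H e₁ dV hdV hdV0 ιA hιA μ hμ a hρ
    μW f μA (P.space.toSubmodule.starProjection : Lp ℂ 2 μA →ₗ[ℂ] Lp ℂ 2 μA) Φ hθ'
  -- the witness as `E(Φ_∞ ⊗ Φ_f)`
  have hΨ : piSchwartzBruhatEquiv (↥(maximalRealSubfield L)) (Fin n') (Φinf ⊗ₜ[ℂ] (⟨Φfin, hfin⟩ : FinSB (↥(maximalRealSubfield L)) (Fin n'))) =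
      ⟨fun v => Φinf (piArch (↥(maximalRealSubfield L)) (Fin n') v) * Φfin (piFinite (↥(maximalRealSubfield L)) (Fin n') v),
        tensor_mem_piSchwartzBruhat Φinf hfin⟩ :=
    Subtype.ext (coe_piSchwartzBruhatEquiv_tmul (↥(maximalRealSubfield L)) (Fin n') Φinf ⟨Φfin, hfin⟩)
  -- the place of `τ′` and the real place below it
  let w₀ : {w : InfinitePlace L // w.IsComplex} := ⟨InfinitePlace.mk τ', IsTotallyComplex.isComplex _⟩
  let v₀ : {v : InfinitePlace (↥(maximalRealSubfield L)) // v.IsReal} :=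
    ⟨w₀.1.comap (algebraMap (↥(maximalRealSubfield L)) L),
      Literature.NumberTheory.GelbartRogawski1991.UnitaryDualPair.ArchSplitting.QuadExt.isReal_comap_of_smul_eq (F := ↥(maximalRealSubfield L))
        (E := L) (c := IsCMField.complexConj L) (w := w₀) (complexConj_smul_infinitePlace L _) (IsCMField.complexConj_ne_one L)⟩
  have hw₀ : (cmPlaceOver L v₀).1 = InfinitePlace.mk τ' :=
    comap_injective_of_isCMField (L := L) (cmPlaceOver_comap L v₀)
  have hw₀' : (cmPlaceOver L v₀).1 ≠ InfinitePlace.mk ι := hw₀ ▸ hτ'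
  have hw₀'' : cmPlaceOver L v₀ ≠ cmPlace L ι := fun h => hw₀' (by rw [h])
  -- the archimedean type of `toHeckeCharacter μ`
  have hτ : (toHeckeCharacter L μ).HasUnitaryArchType hμ.infinityType 0 :=
    (hasUnitaryArchType_toHeckeCharacter_iff L μ _).2 hμ.hasInfinityType_infinityType
  have hodd : ∀ w, Odd (hμ.infinityType w) := hμ.odd_infinityType
  -- positivity of `σ_{v₀}(dV p)` (the letter's `hdef` at `w₀`) and the sign split at `v₀`
  have hH : ((Matrix.diagonal dV).map (cmPlaceOver L v₀).1.embedding).PosDef :=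
    hdef _ (by rw [InfinitePlace.mk_embedding]; exact hw₀')
  have hVpos := embedding_of_isReal_dV_pos_of_posDef_diagonal L dV hdV v₀ hH
  -- the dictionary at `τ′`: `τ′ = σ_{w₀}` or its conjugate
  have hmk : InfinitePlace.mk τ' = InfinitePlace.mk (cmPlaceOver L v₀).1.embedding := by rw [InfinitePlace.mk_embedding, hw₀]
  have hτ'or : τ' = (cmPlaceOver L v₀).1.embedding ∨ τ' = NumberField.ComplexEmbedding.conjugate (cmPlaceOver L v₀).1.embedding := by
    rcases InfinitePlace.mk_eq_iff.1 hmk with h | h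
    · exact Or.inl h
    · refine Or.inr (RingHom.ext fun z => ?_)
      have hz := congrArg (fun φ : L →+* ℂ => φ z) h
      simp only [NumberField.ComplexEmbedding.conjugate_coe_eq] at hz
      rw [NumberField.ComplexEmbedding.conjugate_coe_eq, ← hz, Complex.conj_conj]
  have hIm : ((cmPlaceOver L v₀).1.embedding (algebraMap (↥(maximalRealSubfield L)) L a * (2 * imagUnit L)⁻¹)).im =
      -embedding_of_isReal v₀.2 (a : ↥(maximalRealSubfield L)) / (2 * deltaIm (cmPlaceOver L) (imagUnit L) v₀) :=
    im_embedding_cmPlaceOver_mul_inv_two_imagUnit L v₀ (a : ↥(maximalRealSubfield L))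
  have hImc : (NumberField.ComplexEmbedding.conjugate (cmPlaceOver L v₀).1.embedding
        (algebraMap (↥(maximalRealSubfield L)) L a * (2 * imagUnit L)⁻¹)).im =
      embedding_of_isReal v₀.2 (a : ↥(maximalRealSubfield L)) / (2 * deltaIm (cmPlaceOver L) (imagUnit L) v₀) := by
    rw [NumberField.ComplexEmbedding.conjugate_coe_eq, Complex.conj_im, hIm, neg_div, neg_neg]
  -- the sign of `x_{v₀}` read on `σ_{v₀}(a) / c_{v₀}` (S3a at `k := e₁ (p, 0)`)
  have hsign : ∀ p : Fin 2, signVec (cmPlaceOver L) (cmGramEntry L e₁ dV hdV (lineW L (TW (↥(maximalRealSubfield L)) a))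
      (complexConj_lineW L (TW (↥(maximalRealSubfield L)) a))) (imagUnit L) v₀ (e₁ (p, 0)) =
      embedding_of_isReal v₀.2 (⟨dV p, (IsCMField.complexConj_eq_self_iff (K := L) (dV p)).1 (hdV p)⟩ : ↥(maximalRealSubfield L)) *
        (embedding_of_isReal v₀.2 (a : ↥(maximalRealSubfield L)) / deltaIm (cmPlaceOver L) (imagUnit L) v₀) := fun p => by
    rw [signVec_cmGramEntry_eq, Equiv.symm_apply_apply, mul_div_assoc]
    rfl
  have hd0 : deltaIm (cmPlaceOver L) (imagUnit L) v₀ ≠ 0 :=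
    deltaIm_ne_zero (IsCMField.complexConj_ne_one L) (cmPlaceOver_smul L) (complexConj_imagUnit L) (imagUnit_ne_zero L) v₀
  -- the core: kill the witness unless the exponent at `w₀` is right
  have hkill : ∀ {ε : ℤ}, (∀ (Φf : FinSB (↥(maximalRealSubfield L)) (Fin n')) (φ : 𝓢((Fin n' → mixedEmbedding.mixedSpace ↥(maximalRealSubfield L)), ℂ)),
      ε ≠ 0 → P.space.toSubmodule.starProjection (MemLp.toLp _ (F0LD1ThetaTransportKit.memLp_toQuotFun_lineThetaLift L 2 H e₁ dV hdV hdV0 ιA hιA μ hμ a hρ μW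
        (piSchwartzBruhatEquiv (↥(maximalRealSubfield L)) (Fin n') (φ ⊗ₜ Φf)) f μA 2)) = 0) → ε = 0 := by
    intro ε hcore
    by_contra hε
    apply hne
    rw [← F0LD2ThetaTensorClasses.toLp_lineThetaLift_congr L 2 H e₁ dV hdV hdV0 ιA hιA μ hμ a hρ μW f μA hΨ]
    exact hcore ⟨Φfin, hfin⟩ Φinf hε
  rcases forall_signVec_pos_or_forall_not_of_line L dV hdV v₀ e₁ (lineW L (TW (↥(maximalRealSubfield L)) a))
    (complexConj_lineW L (TW (↥(maximalRealSubfield L)) a)) hVpos with hpos | hneg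
  · -- POSITIVE at `v₀`: `τ_{w₀} = −1` and `Im σ_{w₀}(a·(2δ)⁻¹) < 0`
    have hτw : hμ.infinityType (cmPlaceOver L v₀).1 = -1 := by
      obtain ⟨m, hm'⟩ := hodd (cmPlaceOver L v₀).1
      have h0 : (hμ.infinityType (cmPlaceOver L v₀).1 + 1) / 2 = 0 :=
        hkill fun Φf φ hm0 => starProjection_toLp_lineThetaLift_tmul_eq_zero_of_pos_of_fixed L H e₁ dV hdV hdV0 t ht g hg ιA hιA hpin μ hμ a hρ μW f
          (cmPlace L ι) P hKc v₀ hw₀'' hτ hodd hpos hm0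
          (fun A => exists_archLocal_entries_eq_of_pos L e₁ dV hdV hdV0 (lineW L (TW (↥(maximalRealSubfield L)) a))
            (complexConj_lineW L (TW (↥(maximalRealSubfield L)) a)) (lineW_ne_zero L (TW (↥(maximalRealSubfield L)) a) (isUnit_det_TW (↥(maximalRealSubfield L)) a))
            v₀ hpos A)
          (fun W β => carrierConjEquiv_frameD_placeBlock_mulSingle_doubled_archBoxTensor L e₁ dV hdV hdV0 (lineW L (TW (↥(maximalRealSubfield L)) a))
            (complexConj_lineW L (TW (↥(maximalRealSubfield L)) a)) (lineW_ne_zero L (TW (↥(maximalRealSubfield L)) a) (isUnit_det_TW (↥(maximalRealSubfield L)) a))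
            W v₀ β 0)
          φ Φf
      omega
    -- the sign: `0 < σ_{v₀}(a) / c_{v₀}`
    have hs : 0 < embedding_of_isReal v₀.2 (a : ↥(maximalRealSubfield L)) / deltaIm (cmPlaceOver L) (imagUnit L) v₀ := by
      have h := hpos (e₁ ((0 : Fin 2), 0))
      rw [hsign] at h
      exact (mul_pos_iff_of_pos_left (hVpos 0)).1 h
    rcases hτ'or with hτ'eq | hτ'eq
    · left
      refine ⟨by rw [hτ'eq, exponentAt_embedding, hτw], ?_⟩
      rw [hτ'eq, hIm, neg_div, neg_lt_zero, mul_comm (2 : ℝ), ← div_div]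
      exact div_pos hs two_pos
    · right
      refine ⟨by rw [hτ'eq, exponentAt_conjugate_embedding _ (cmPlaceOver L v₀).2, hτw]; norm_num, ?_⟩
      rw [hτ'eq, hImc, mul_comm (2 : ℝ), ← div_div]
      exact div_pos hs two_pos
  · -- NEGATIVE at `v₀`: `τ_{w₀} = 1` and `0 < Im σ_{w₀}(a·(2δ)⁻¹)`
    have hτw : hμ.infinityType (cmPlaceOver L v₀).1 = 1 := by
      obtain ⟨m, hm'⟩ := hodd (cmPlaceOver L v₀).1
      have h0 : (1 - hμ.infinityType (cmPlaceOver L v₀).1) / 2 = 0 :=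
        hkill fun Φf φ hm0 => starProjection_toLp_lineThetaLift_tmul_eq_zero_of_neg_of_fixed L H e₁ dV hdV hdV0 t ht g hg ιA hιA hpin μ hμ a hρ μW f
          (cmPlace L ι) P hKc v₀ hw₀'' hτ hodd hneg hm0
          (fun A => exists_archLocal_entries_eq_of_neg L e₁ dV hdV hdV0 (lineW L (TW (↥(maximalRealSubfield L)) a))
            (complexConj_lineW L (TW (↥(maximalRealSubfield L)) a)) (lineW_ne_zero L (TW (↥(maximalRealSubfield L)) a) (isUnit_det_TW (↥(maximalRealSubfield L)) a))
            v₀ hneg A)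
          (fun W β => carrierConjEquiv_frameD_placeBlock_mulSingle_doubled_archBoxTensor L e₁ dV hdV hdV0 (lineW L (TW (↥(maximalRealSubfield L)) a))
            (complexConj_lineW L (TW (↥(maximalRealSubfield L)) a)) (lineW_ne_zero L (TW (↥(maximalRealSubfield L)) a) (isUnit_det_TW (↥(maximalRealSubfield L)) a))
            W v₀ β 0)
          φ Φf
      omega
    -- the sign: `σ_{v₀}(a) / c_{v₀} < 0`
    have hs : embedding_of_isReal v₀.2 (a : ↥(maximalRealSubfield L)) / deltaIm (cmPlaceOver L) (imagUnit L) v₀ < 0 := by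
      have h := hneg (e₁ ((0 : Fin 2), 0))
      rw [hsign] at h
      have hne0 : embedding_of_isReal v₀.2 (a : ↥(maximalRealSubfield L)) / deltaIm (cmPlaceOver L) (imagUnit L) v₀ ≠ 0 :=
        div_ne_zero ((map_ne_zero _).2 (Units.ne_zero a)) hd0
      rcases lt_trichotomy (embedding_of_isReal v₀.2 (a : ↥(maximalRealSubfield L)) / deltaIm (cmPlaceOver L) (imagUnit L) v₀) 0 with hlt | heq | hgt
      · exact hlt
      · exact absurd heq hne0
      · exact absurd (mul_pos (hVpos 0) hgt) h
    rcases hτ'or with hτ'eq | hτ'eq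
    · right
      refine ⟨by rw [hτ'eq, exponentAt_embedding, hτw], ?_⟩
      rw [hτ'eq, hIm, neg_div, mul_comm (2 : ℝ), ← div_div]
      exact neg_pos.2 (div_neg_of_neg_of_pos hs two_pos)
    · left
      refine ⟨by rw [hτ'eq, exponentAt_conjugate_embedding _ (cmPlaceOver L v₀).2, hτw], ?_⟩
      rw [hτ'eq, hImc, mul_comm (2 : ℝ), ← div_div]
      exact div_neg_of_neg_of_pos hs two_pos

end Summit.HodgeConjecture.HodgeConjecture.Cruxes.HLiu418.F0LD1ArchTypeAwayOfInvariant

end
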